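import Literature.Analysis.FluidPDE.TaoAveragedComplexAverage
import Mathlib.Analysis.InnerProductSpace.Calculus
import Mathlib.Analysis.Calculus.ContDiff.Bounds
import Mathlib.Analysis.Calculus.IteratedDeriv.Lemmas
import Mathlib.Analysis.SpecialFunctions.Log.Deriv
import Mathlib.Analysis.SpecialFunctions.ExpDeriv
import Mathlib.Analysis.Complex.RealDeriv
import HarnessLib

/-!
# Tao 2016, §3.3: the imaginary-order operators `D^{it}` are Fourier multipliers of order `0`

T. Tao, *Finite time blowup for an averaged three-dimensional Navier–Stokes equation*,
J. Amer. Math. Soc. **29** (2016), 601–674 = arXiv:1402.0290v3, §3.3, p. 16: "We now use some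
differential operators of imaginary order to localise the frequencies `ξ₁, ξ₂, ξ₃` to be
comparable to each other in magnitude. … where `D^{it}` is the Fourier multiplier
`\widehat{D^{it} u}(ξ) := |ξ|^{it} û(ξ)` … (note that `‖D^{it}‖_k` grows polynomially in `t` for
each `k`)."

This file proves that parenthetical remark for the tree's symbol class (`IsComplexSymbol`,
`symbolSeminorm`, `TaoAveragedComplexAverage.lean` / `TaoAveragedSobolev.lean`):

* `imagPow t ξ = |ξ|^{it} = e^{it log|ξ|}` (junk value `1` at `ξ = 0`, where `Real.log 0 = 0`; the
  origin is a null set and symbols are only evaluated off it);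
* `contDiffOn_imagPow` — smooth off the origin;
* `norm_pow_mul_norm_iteratedFDeriv_imagPow_le` — **scale invariance**: `|ξ|ᵏ ‖∇ᵏ|ξ|^{it}‖` at
  `ξ ≠ 0` is at most its value at `ξ/|ξ|` (from `|λξ|^{it} = λ^{it} |ξ|^{it}`, `|λ^{it}| = 1`, and the
  chain rule for the linear map `ξ ↦ λξ`);
* `exists_bound_iteratedFDeriv_imagPow_sphere` — on the unit sphere `‖∇ᵏ|ξ|^{it}‖ ≤ M_k max(1,|t|)ᵏ`
  (the Faà di Bruno bound `norm_iteratedFDerivWithin_comp_le` for `r ↦ e^{itr}` composed with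
  `ξ ↦ log|ξ|`, whose derivatives are bounded on the compact sphere);
* `symbolSeminorm_imagPow_le` — **`‖D^{it}‖_k ≤ A_k (1+|t|)ᵏ`** with absolute constants
  `A_k = imagPowConst k`, and `isComplexSymbol_imagPow` — `|ξ|^{it} ∈ 𝓜₀ ⊗ ℂ`.

These are the multipliers of the complex averaging datum that represents `B_η` as a complex
average of `B` (§3.3; the discharge of `betaForm_isComplexAverage` lives in
`TaoAveragedBetaForm.lean`).

## References

* T. Tao, J. Amer. Math. Soc. 29 (2016), 601–674, arXiv:1402.0290v3, §3.3 p. 16, (1.10). Key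
  `Tao2016AveragedNS`.
-/

noncomputable section

open Set Filter
open scoped ENNReal NNReal Topology Nat

namespace Literature.Analysis.FluidPDE.Tao2016

/-- Local notation for physical / frequency space `ℝ³`. -/
local notation "ℝ³" => EuclideanSpace ℝ (Fin 3)

/-! ### The symbols `|ξ|^{it}` and the one-variable exponentials `e^{itr}` -/

/-- The symbol **`|ξ|^{it} = e^{it log |ξ|}`** of the imaginary-order operator `D^{it}`,
`\widehat{D^{it}u}(ξ) = |ξ|^{it} û(ξ)` (Tao 2016, §3.3). Junk value `1` at `ξ = 0`
(`Real.log 0 = 0`), a null set. [cite: Tao2016AveragedNS, §3.3 p. 16] -/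
def imagPow (t : ℝ) (ξ : ℝ³) : ℂ := Complex.exp (((t * Real.log ‖ξ‖ : ℝ) : ℂ) * Complex.I)

/-- The one-variable exponential `r ↦ e^{itr}`, so that `|ξ|^{it} = e^{it·} ∘ log |·|`. [folklore] -/
def imagExp (t r : ℝ) : ℂ := Complex.exp (((t * r : ℝ) : ℂ) * Complex.I)

/-- `|ξ|^{it} = (r ↦ e^{itr}) ∘ (ξ ↦ log |ξ|)`. [folklore] -/
theorem imagPow_eq_comp (t : ℝ) : imagPow t = imagExp t ∘ fun ξ : ℝ³ => Real.log ‖ξ‖ := rfl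

/-- `| |ξ|^{it} | = 1`. [folklore] -/
theorem norm_imagPow (t : ℝ) (ξ : ℝ³) : ‖imagPow t ξ‖ = 1 :=
  Complex.norm_exp_ofReal_mul_I _

/-- `|e^{itr}| = 1`. [folklore] -/
theorem norm_imagExp (t r : ℝ) : ‖imagExp t r‖ = 1 :=
  Complex.norm_exp_ofReal_mul_I _

/-- `|ξ|^{it} ≠ 0`. [folklore] -/
theorem imagPow_ne_zero (t : ℝ) (ξ : ℝ³) : imagPow t ξ ≠ 0 :=
  Complex.exp_ne_zero _

/-- `|ξ|^{i0} = 1`. [folklore] -/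
theorem imagPow_zero_left (ξ : ℝ³) : imagPow 0 ξ = 1 := by
  simp [imagPow]

/-- The group law `|ξ|^{i(t+t')} = |ξ|^{it} |ξ|^{it'}`. [folklore] -/
theorem imagPow_add (t t' : ℝ) (ξ : ℝ³) : imagPow (t + t') ξ = imagPow t ξ * imagPow t' ξ := by
  unfold imagPow
  rw [← Complex.exp_add]
  congr 1
  push_cast
  ring

/-- **Homogeneity**: `|λξ|^{it} = e^{it log λ} |ξ|^{it}` for `λ > 0`, `ξ ≠ 0`. [folklore] -/
theorem imagPow_smul {a : ℝ} (ha : 0 < a) (t : ℝ) {ξ : ℝ³} (hξ : ξ ≠ 0) :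
    imagPow t (a • ξ) = imagExp t (Real.log a) * imagPow t ξ := by
  unfold imagPow imagExp
  rw [norm_smul, Real.norm_eq_abs, abs_of_pos ha, Real.log_mul ha.ne' (norm_ne_zero_iff.2 hξ),
    ← Complex.exp_add]
  congr 1
  push_cast
  ring

/-- `(t, ξ) ↦ |ξ|^{it}` is jointly measurable. [folklore] -/
theorem measurable_imagPow : Measurable fun p : ℝ × ℝ³ => imagPow p.1 p.2 := by
  unfold imagPow
  refine Complex.continuous_exp.measurable.comp ?_
  refine Measurable.mul_const (Complex.measurable_ofReal.comp ?_) _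
  exact measurable_fst.mul (Real.measurable_log.comp measurable_snd.norm)

/-- `t ↦ |ξ|^{it}` is continuous. [folklore] -/
theorem continuous_imagPow_left (ξ : ℝ³) : Continuous fun t : ℝ => imagPow t ξ := by
  unfold imagPow
  fun_prop

/-- `t ↦ |ξ|^{it}` is measurable. [folklore] -/
theorem measurable_imagPow_left (ξ : ℝ³) : Measurable fun t : ℝ => imagPow t ξ :=
  (continuous_imagPow_left ξ).measurable

/-! ### Smoothness -/

/-- `r ↦ e^{itr}` is smooth. [folklore] -/
theorem contDiff_imagExp (t : ℝ) {n : WithTop ℕ∞} : ContDiff ℝ n (imagExp t) := by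
  unfold imagExp
  have h : ContDiff ℝ n fun r : ℝ => ((t * r : ℝ) : ℂ) :=
    Complex.ofRealCLM.contDiff.comp (contDiff_const.mul contDiff_id)
  exact (h.mul contDiff_const).cexp

/-- `ξ ↦ log |ξ|` is smooth off the origin. [folklore] -/
theorem contDiffOn_logNorm {n : WithTop ℕ∞} :
    ContDiffOn ℝ n (fun ξ : ℝ³ => Real.log ‖ξ‖) {0}ᶜ := fun _ hξ =>
  ((contDiffAt_id.norm ℝ hξ).log (norm_ne_zero_iff.2 hξ)).contDiffWithinAt

/-- **`|ξ|^{it}` is smooth off the origin.** [cite: Tao2016AveragedNS, §3.3 p. 16] -/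
theorem contDiffOn_imagPow (t : ℝ) {n : WithTop ℕ∞} : ContDiffOn ℝ n (imagPow t) {0}ᶜ :=
  (contDiff_imagExp t).comp_contDiffOn contDiffOn_logNorm

/-! ### The derivatives of `r ↦ e^{itr}` have norm `|t|ⁿ` -/

/-- `(e^{itr})' = it e^{itr}`. [folklore] -/
theorem hasDerivAt_imagExp (t r : ℝ) :
    HasDerivAt (imagExp t) ((t : ℂ) * Complex.I * imagExp t r) r := by
  have h1 : HasDerivAt (fun r : ℝ => ((t * r : ℝ) : ℂ)) ((t * 1 : ℝ) : ℂ) r :=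
    ((hasDerivAt_id r).const_mul t).ofReal_comp
  have h2 : HasDerivAt (fun r : ℝ => ((t * r : ℝ) : ℂ) * Complex.I) (((t * 1 : ℝ) : ℂ) * Complex.I) r :=
    h1.mul_const _
  have h3 := h2.cexp
  unfold imagExp
  convert h3 using 1
  push_cast
  ring

/-- `(e^{itr})' = it e^{itr}` as an identity of functions. [folklore] -/
theorem deriv_imagExp (t : ℝ) : deriv (imagExp t) = fun r => (t : ℂ) * Complex.I * imagExp t r :=
  funext fun r => (hasDerivAt_imagExp t r).deriv

/-- `(e^{itr})^{(n)} = (it)ⁿ e^{itr}`. [folklore] -/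
theorem iteratedDeriv_imagExp (t : ℝ) (n : ℕ) :
    iteratedDeriv n (imagExp t) = fun r => ((t : ℂ) * Complex.I) ^ n * imagExp t r := by
  induction n with
  | zero =>
      funext r
      simp [iteratedDeriv_zero]
  | succ n ih =>
      rw [iteratedDeriv_succ', deriv_imagExp]
      funext r
      rw [iteratedDeriv_const_mul _ (contDiff_imagExp t).contDiffAt, congrFun ih r, pow_succ]
      ring

/-- **`‖∇ⁿ e^{it·}(r)‖ = |t|ⁿ`.** [folklore] -/
theorem norm_iteratedFDeriv_imagExp (t : ℝ) (n : ℕ) (r : ℝ) :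
    ‖iteratedFDeriv ℝ n (imagExp t) r‖ = |t| ^ n := by
  rw [norm_iteratedFDeriv_eq_norm_iteratedDeriv, iteratedDeriv_imagExp]
  simp only [norm_mul, norm_pow, Complex.norm_real, Complex.norm_I, Real.norm_eq_abs, mul_one,
    norm_imagExp]

/-! ### Derivatives of `log |ξ|` are bounded on the unit sphere -/

/-- The unit sphere avoids the origin. [folklore] -/
theorem sphere_subset_compl_zero : Metric.sphere (0 : ℝ³) 1 ⊆ ({0}ᶜ : Set ℝ³) := by
  intro ζ hζ h0
  rw [mem_singleton_iff] at h0
  rw [h0, mem_sphere_zero_iff_norm, norm_zero] at hζ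
  exact zero_ne_one hζ

/-- Each derivative of `ξ ↦ log |ξ|` (within `{0}ᶜ`) is bounded on the compact unit sphere. [folklore] -/
theorem exists_bound_iteratedFDerivWithin_logNorm (i : ℕ) :
    ∃ B : ℝ, ∀ ζ ∈ Metric.sphere (0 : ℝ³) 1,
      ‖iteratedFDerivWithin ℝ i (fun ξ : ℝ³ => Real.log ‖ξ‖) {0}ᶜ ζ‖ ≤ B := by
  have hcont : ContinuousOn (iteratedFDerivWithin ℝ i (fun ξ : ℝ³ => Real.log ‖ξ‖) {0}ᶜ) {0}ᶜ :=
    (contDiffOn_logNorm (n := ((⊤ : ℕ∞) : WithTop ℕ∞))).continuousOn_iteratedFDerivWithin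
      (by exact_mod_cast le_top) isOpen_compl_singleton.uniqueDiffOn
  exact (isCompact_sphere (0 : ℝ³) 1).exists_bound_of_continuousOn
    (hcont.mono sphere_subset_compl_zero)

/-- **On the unit sphere, `‖∇ᵏ|ξ|^{it}‖ ≤ M_k max(1,|t|)ᵏ`** with `M_k` independent of `t`: the
Faà di Bruno bound for `e^{it·} ∘ log|·|` (`‖(e^{it·})^{(i)}‖ = |t|ⁱ ≤ max(1,|t|)ᵏ`, derivatives of
`log|·|` of orders `1 … k` bounded by a common `D ≥ 1` on the sphere). [cite: Tao2016AveragedNS, §3.3 p. 16] -/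
theorem exists_bound_iteratedFDeriv_imagPow_sphere (k : ℕ) :
    ∃ M : ℝ, 0 ≤ M ∧ ∀ (t : ℝ), ∀ ζ ∈ Metric.sphere (0 : ℝ³) 1,
      ‖iteratedFDeriv ℝ k (imagPow t) ζ‖ ≤ M * (max 1 |t|) ^ k := by
  choose B hB using exists_bound_iteratedFDerivWithin_logNorm
  set D : ℝ := max 1 (∑ i ∈ Finset.range (k + 1), |B i|) with hD
  have hD1 : 1 ≤ D := le_max_left _ _
  have hBD : ∀ i, i ≤ k → B i ≤ D := by
    intro i hi
    refine (le_abs_self _).trans (le_trans ?_ (le_max_right _ _))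
    exact Finset.single_le_sum (f := fun j => |B j|) (fun j _ => abs_nonneg (B j))
      (Finset.mem_range.2 (Nat.lt_succ_of_le hi))
  have hopen : IsOpen ({0}ᶜ : Set ℝ³) := isOpen_compl_singleton
  refine ⟨k ! * D ^ k, by positivity, fun t ζ hζ => ?_⟩
  have hζ0 : ζ ∈ ({0}ᶜ : Set ℝ³) := sphere_subset_compl_zero hζ
  rw [← iteratedFDerivWithin_of_isOpen k hopen hζ0, imagPow_eq_comp]
  have hC : ∀ i, i ≤ k →
      ‖iteratedFDerivWithin ℝ i (imagExp t) univ (Real.log ‖ζ‖)‖ ≤ (max 1 |t|) ^ k := by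
    intro i hi
    rw [iteratedFDerivWithin_univ, norm_iteratedFDeriv_imagExp]
    exact (pow_le_pow_left₀ (abs_nonneg t) (le_max_right 1 |t|) i).trans
      (pow_le_pow_right₀ (le_max_left 1 |t|) hi)
  have hDi : ∀ i, 1 ≤ i → i ≤ k →
      ‖iteratedFDerivWithin ℝ i (fun ξ : ℝ³ => Real.log ‖ξ‖) {0}ᶜ ζ‖ ≤ D ^ i := by
    intro i hi1 hik
    exact (hB i ζ hζ).trans ((hBD i hik).trans (le_self_pow₀ hD1 (by omega)))
  have h := norm_iteratedFDerivWithin_comp_le (𝕜 := ℝ) (g := imagExp t)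
    (f := fun ξ : ℝ³ => Real.log ‖ξ‖) (n := k) (s := {0}ᶜ) (t := univ) (x := ζ)
    (N := ((k : ℕ∞) : WithTop ℕ∞)) (contDiff_imagExp t).contDiffOn contDiffOn_logNorm le_rfl
    uniqueDiffOn_univ hopen.uniqueDiffOn (mapsTo_univ _ _) hζ0 hC hDi
  calc ‖iteratedFDerivWithin ℝ k (imagExp t ∘ fun ξ : ℝ³ => Real.log ‖ξ‖) {0}ᶜ ζ‖
      ≤ k ! * (max 1 |t|) ^ k * D ^ k := h
    _ = k ! * D ^ k * (max 1 |t|) ^ k := by ring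

/-! ### Scale invariance of the seminorms of `|ξ|^{it}` -/

/-- **Scale invariance**: for `ξ ≠ 0`, `|ξ|ᵏ ‖∇ᵏ|ξ|^{it}(ξ)‖ ≤ ‖∇ᵏ|ξ|^{it}(ξ/|ξ|)‖` (in fact
equality), from `|λξ|^{it} = λ^{it}|ξ|^{it}`, `|λ^{it}| = 1` and the chain rule for `ξ ↦ λξ`,
`λ = 1/|ξ|`. [cite: Tao2016AveragedNS, (1.10) and §3.3 p. 16] -/
theorem norm_pow_mul_norm_iteratedFDeriv_imagPow_le (t : ℝ) (k : ℕ) {ξ : ℝ³} (hξ : ξ ≠ 0) :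
    ‖ξ‖ ^ k * ‖iteratedFDeriv ℝ k (imagPow t) ξ‖ ≤
      ‖iteratedFDeriv ℝ k (imagPow t) (‖ξ‖⁻¹ • ξ)‖ := by
  have hnorm : 0 < ‖ξ‖ := norm_pos_iff.2 hξ
  set a : ℝ := ‖ξ‖⁻¹ with ha_def
  have ha : 0 < a := inv_pos.2 hnorm
  set g : ℝ³ →L[ℝ] ℝ³ := a • ContinuousLinearMap.id ℝ ℝ³ with hg_def
  have hg : ∀ x, g x = a • x := fun x => rfl
  have hopen : IsOpen ({0}ᶜ : Set ℝ³) := isOpen_compl_singleton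
  have hpre : g ⁻¹' ({0}ᶜ : Set ℝ³) = {0}ᶜ := by
    ext x
    simp [hg, ha.ne']
  have hξ' : ξ ∈ ({0}ᶜ : Set ℝ³) := hξ
  have hgξ : a • ξ ∈ ({0}ᶜ : Set ℝ³) := smul_ne_zero ha.ne' hξ
  -- (1) chain rule on the right
  have h1 : iteratedFDerivWithin ℝ k (imagPow t ∘ g) {0}ᶜ ξ =
      (iteratedFDerivWithin ℝ k (imagPow t) {0}ᶜ (a • ξ)).compContinuousLinearMap fun _ => g := by
    have h := g.iteratedFDerivWithin_comp_right (f := imagPow t) (n := ((k : ℕ∞) : WithTop ℕ∞))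
      (contDiffOn_imagPow t) hopen.uniqueDiffOn (by rw [hpre]; exact hopen.uniqueDiffOn) (x := ξ)
      (by rw [hg]; exact hgξ) (i := k) le_rfl
    rw [hpre, hg] at h
    exact h
  -- (2) the composite is a unimodular multiple of `|ξ|^{it}` off the origin
  have h2 : EqOn (imagPow t ∘ g) (imagExp t (Real.log a) • imagPow t) {0}ᶜ := by
    intro x hx
    simp only [Function.comp_apply, hg, Pi.smul_apply, smul_eq_mul]
    exact imagPow_smul ha t hx
  have h3 : iteratedFDerivWithin ℝ k (imagPow t ∘ g) {0}ᶜ ξ =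
      imagExp t (Real.log a) • iteratedFDerivWithin ℝ k (imagPow t) {0}ᶜ ξ := by
    rw [iteratedFDerivWithin_congr h2 hξ']
    exact iteratedFDerivWithin_const_smul_apply ((contDiffOn_imagPow t (n := (k : WithTop ℕ∞))) ξ hξ')
      hopen.uniqueDiffOn hξ'
  -- (3) compare norms
  have hnormg : ‖g‖ ≤ a := by
    rw [hg_def, norm_smul, Real.norm_eq_abs, abs_of_pos ha]
    exact mul_le_of_le_one_right ha.le ContinuousLinearMap.norm_id_le
  have h4 : ‖iteratedFDerivWithin ℝ k (imagPow t) {0}ᶜ ξ‖ ≤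
      a ^ k * ‖iteratedFDerivWithin ℝ k (imagPow t) {0}ᶜ (a • ξ)‖ := by
    have e : ‖iteratedFDerivWithin ℝ k (imagPow t) {0}ᶜ ξ‖ =
        ‖iteratedFDerivWithin ℝ k (imagPow t ∘ g) {0}ᶜ ξ‖ := by
      rw [h3, norm_smul, norm_imagExp, one_mul]
    rw [e, h1]
    refine (ContinuousMultilinearMap.norm_compContinuousLinearMap_le _ _).trans ?_
    rw [Finset.prod_const, Finset.card_univ, Fintype.card_fin, mul_comm]
    exact mul_le_mul_of_nonneg_right (pow_le_pow_left₀ (norm_nonneg _) hnormg k) (norm_nonneg _)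
  rw [← iteratedFDerivWithin_of_isOpen k hopen hξ', ← iteratedFDerivWithin_of_isOpen k hopen hgξ]
  calc ‖ξ‖ ^ k * ‖iteratedFDerivWithin ℝ k (imagPow t) {0}ᶜ ξ‖
      ≤ ‖ξ‖ ^ k * (a ^ k * ‖iteratedFDerivWithin ℝ k (imagPow t) {0}ᶜ (a • ξ)‖) := by
        gcongr
    _ = ‖iteratedFDerivWithin ℝ k (imagPow t) {0}ᶜ (a • ξ)‖ := by
        rw [← mul_assoc, ← mul_pow, ha_def, mul_inv_cancel₀ hnorm.ne', one_pow, one_mul]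

/-! ### Polynomial growth of `‖D^{it}‖_k` -/

/-- **`|ξ|ᵏ ‖∇ᵏ|ξ|^{it}(ξ)‖ ≤ A_k (1+|t|)ᵏ` for all `ξ ≠ 0`**, with absolute constants `A_k`. [cite: Tao2016AveragedNS, §3.3 p. 16] -/
theorem exists_seminorm_bound_imagPow :
    ∃ A : ℕ → ℝ, (∀ k, 0 ≤ A k) ∧ ∀ (k : ℕ) (t : ℝ) (ξ : ℝ³), ξ ≠ 0 →
      ‖ξ‖ ^ k * ‖iteratedFDeriv ℝ k (imagPow t) ξ‖ ≤ A k * (1 + |t|) ^ k := by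
  choose M hM0 hM using exists_bound_iteratedFDeriv_imagPow_sphere
  refine ⟨M, hM0, fun k t ξ hξ => ?_⟩
  have hnorm : 0 < ‖ξ‖ := norm_pos_iff.2 hξ
  have hζ : ‖ξ‖⁻¹ • ξ ∈ Metric.sphere (0 : ℝ³) 1 := by
    rw [mem_sphere_zero_iff_norm, norm_smul, norm_inv, norm_norm, inv_mul_cancel₀ hnorm.ne']
  calc ‖ξ‖ ^ k * ‖iteratedFDeriv ℝ k (imagPow t) ξ‖
      ≤ ‖iteratedFDeriv ℝ k (imagPow t) (‖ξ‖⁻¹ • ξ)‖ :=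
        norm_pow_mul_norm_iteratedFDeriv_imagPow_le t k hξ
    _ ≤ M k * (max 1 |t|) ^ k := hM k t _ hζ
    _ ≤ M k * (1 + |t|) ^ k := by
        gcongr
        · exact hM0 k
        · exact max_le (by linarith [abs_nonneg t]) (by linarith)

/-- The absolute constants `A_k` in `‖D^{it}‖_k ≤ A_k (1+|t|)ᵏ`. [cite: Tao2016AveragedNS, §3.3 p. 16] -/
def imagPowConst : ℕ → ℝ := Classical.choose exists_seminorm_bound_imagPow

/-- `A_k ≥ 0`. [folklore] -/
theorem imagPowConst_nonneg (k : ℕ) : 0 ≤ imagPowConst k :=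
  (Classical.choose_spec exists_seminorm_bound_imagPow).1 k

/-- `|ξ|ᵏ ‖∇ᵏ|ξ|^{it}(ξ)‖ ≤ A_k (1+|t|)ᵏ` for `ξ ≠ 0`. [cite: Tao2016AveragedNS, §3.3 p. 16] -/
theorem norm_pow_mul_norm_iteratedFDeriv_imagPow_le_const (k : ℕ) (t : ℝ) {ξ : ℝ³} (hξ : ξ ≠ 0) :
    ‖ξ‖ ^ k * ‖iteratedFDeriv ℝ k (imagPow t) ξ‖ ≤ imagPowConst k * (1 + |t|) ^ k :=
  (Classical.choose_spec exists_seminorm_bound_imagPow).2 k t ξ hξ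

/-- **`‖D^{it}‖_k ≤ A_k (1+|t|)ᵏ`: the seminorms (1.10) of `|ξ|^{it}` grow polynomially in `t`**
("note that `‖D^{it}‖_k` grows polynomially in `t` for each `k`", Tao p. 16). [cite: Tao2016AveragedNS, §3.3 p. 16] -/
theorem symbolSeminorm_imagPow_le (k : ℕ) (t : ℝ) :
    symbolSeminorm k (imagPow t) ≤ ENNReal.ofReal (imagPowConst k * (1 + |t|) ^ k) := by
  refine iSup₂_le fun ξ hξ => ?_
  have hξ' : ξ ≠ 0 := hξ
  calc (‖ξ‖₊ : ℝ≥0∞) ^ k * ‖iteratedFDeriv ℝ k (imagPow t) ξ‖₊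
      = ENNReal.ofReal (‖ξ‖ ^ k * ‖iteratedFDeriv ℝ k (imagPow t) ξ‖) := by
        rw [ENNReal.ofReal_mul (by positivity), ENNReal.ofReal_pow (norm_nonneg _), ofReal_norm,
          ofReal_norm, enorm_eq_nnnorm, enorm_eq_nnnorm]
    _ ≤ ENNReal.ofReal (imagPowConst k * (1 + |t|) ^ k) :=
        ENNReal.ofReal_le_ofReal (norm_pow_mul_norm_iteratedFDeriv_imagPow_le_const k t hξ')

/-- **`D^{it}` is a (complex) Fourier multiplier of order `0`**: `|ξ|^{it} ∈ 𝓜₀ ⊗ ℂ`. [cite: Tao2016AveragedNS, §3.3 p. 16] -/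
theorem isComplexSymbol_imagPow (t : ℝ) : IsComplexSymbol (imagPow t) :=
  ⟨contDiffOn_imagPow t, fun k =>
    lt_of_le_of_lt (symbolSeminorm_imagPow_le k t) ENNReal.ofReal_lt_top⟩

end Literature.Analysis.FluidPDE.Tao2016
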